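import Mathlib
import HarnessLib
import Summits.NavierStokesRegularity.NavierStokesRegularity.Theorems.PoloidalWindowDoorLrcModEntireJetCertPsatzElimH

/-!
# Jet-certificate checker — content removal with a QUICK DIVISIBILITY TEST (`(1 + X_g²) ∣ p  ⇔  p(i) = 0`)

Cell pub-ns-dss, seat ns-crc-p1 gen 5 (Lean-certificate hand of `ns-wall-extremal`, arm C; PREREG-WALL-1 §C, all-tilt cells of ≥ 60 k terms), 2026-08-28.
`--supports stmt-NavierStokesRegularity-19708` (instrument).  Generic; no Navier–Stokes content.  In `…ElimG/H` the division of a law by `1 + X_g²`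
is ATTEMPTED by peeling and verified by re-multiplication; on a law that is not divisible the attempt still peels every layer before failing — the
dominant cost on the (3,5) all-tilt cell (525 s on the farm).  Here an exact Boolean pre-test decides divisibility first: writing
`p = Σ_k X_g^k · P_k`, `(1 + X_g²) ∣ p` iff `p(i) = 0` iff `Σ_{k≡0 (4)} P_k = Σ_{k≡2 (4)} P_k` and `Σ_{k≡1 (4)} P_k = Σ_{k≡3 (4)} P_k` (`quadDivisible`);
the test only GATES the (still verified) peeling, so soundness is word for word that of `…ElimG`.  Same nodes, same conclusion (`Kills`).

* `partMod4`, `quadDivisible`; `stripQuadI`, `ev_stripQuadI`; `stripCI`, `ev_stripCI_eq_zero`; `substStripI`, `ev_substStripI_eq_zero`;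
  `etreeCheckI` + `not_pointDatum_of_etreeCheckI`; `killCheckI` + **`kills_of_killCheckI`**; self-test.

WHAT THIS IS NOT: not a claim about Navier–Stokes, not a certificate. [folklore]
-/

noncomputable section

-- the summit and its single sub-problem share the name (CONVENTIONS §1), as in every Theorems file
set_option linter.dupNamespace false

namespace Summit.NavierStokesRegularity.NavierStokesRegularity.Theorems.PoloidalWindowDoorLrcModEntireJetCertPsatzElimI

open _root_.Topology _root_.Filter Set
open Literature.Analysis.ValidatedNumerics Literature.Analysis.ValidatedNumerics.QMvPoly
open Literature.Analysis.Calculus.MvPoly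
open Summit.NavierStokesRegularity.NavierStokesRegularity.Theorems.PoloidalWindowDoorLrcModEntireJetCertDefs
open Summit.NavierStokesRegularity.NavierStokesRegularity.Theorems.PoloidalWindowDoorLrcModEntireJetCertTree
open Summit.NavierStokesRegularity.NavierStokesRegularity.Theorems.PoloidalWindowDoorLrcModEntireJetCertFast2
open Summit.NavierStokesRegularity.NavierStokesRegularity.Theorems.PoloidalWindowDoorLrcModEntireJetCertGauge
open Summit.NavierStokesRegularity.NavierStokesRegularity.Theorems.PoloidalWindowDoorLrcModEntireJetCertPsatz
open Summit.NavierStokesRegularity.NavierStokesRegularity.Theorems.PoloidalWindowDoorLrcModEntireJetCertPsatzSubst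
open Summit.NavierStokesRegularity.NavierStokesRegularity.Theorems.PoloidalWindowDoorLrcModEntireJetCertPsatzElim
open Summit.NavierStokesRegularity.NavierStokesRegularity.Theorems.PoloidalWindowDoorLrcModEntireJetCertPsatzElimN
open Summit.NavierStokesRegularity.NavierStokesRegularity.Theorems.PoloidalWindowDoorLrcModEntireJetCertPsatzElimG
open Summit.NavierStokesRegularity.NavierStokesRegularity.Theorems.PoloidalWindowDoorLrcModEntireJetCertPsatzElimH

variable {n : ℕ}

/-! ### The divisibility pre-test -/

/-- The part of `p` whose `g`-exponent is `≡ r (mod 4)`, with `X_g` removed. [folklore] -/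
def partMod4 (g r : ℕ) (p : QMvPoly) : QMvPoly :=
  (p.filter fun t => t.1.getD g 0 % 4 = r).map fun t => (zeroAt t.1 g, t.2)

/-- `(1 + X_g²) ∣ p` as a Boolean: `p(i) = 0`, i.e. the mod-4 parts satisfy `P₀ = P₂` and `P₁ = P₃` (a gate only — the quotient is still verified). [folklore] -/
def quadDivisible (g : ℕ) (p : QMvPoly) : Bool :=
  polyEq (partMod4 g 0 p) (partMod4 g 2 p) && polyEq (partMod4 g 1 p) (partMod4 g 3 p)

/-- Divide by `1 + X_g²` while the pre-test says divisible (quotient by peeling, VERIFIED by re-multiplication; fuel-bounded). [folklore] -/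
def stripQuadI (n g : ℕ) : ℕ → QMvPoly → QMvPoly
  | 0, p => p
  | f + 1, p =>
      if quadDivisible g p then
        (let rq := peelQuad n g (maxExpG g p + 1) p []
         if rq.1 = [] ∧ polyEq p (mulN rq.2 (onePlusSq n g)) = true then stripQuadI n g f rq.2 else p)
      else p

/-- `p(z) = (1 + z_g²)^k · (stripQuadI p)(z)` for some `k`. [folklore] -/
theorem ev_stripQuadI (z : EuclideanSpace ℝ (Fin n)) (g : Fin n) :
    ∀ (f : ℕ) (p : QMvPoly), ∃ k : ℕ, ev n p z = (1 + z g ^ 2) ^ k * ev n (stripQuadI n g f p) z := by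
  intro f
  induction f with
  | zero => intro p; exact ⟨0, by simp [stripQuadI]⟩
  | succ f ih =>
    intro p
    simp only [stripQuadI]
    split_ifs with hq h
    · obtain ⟨k, hk⟩ := ih (peelQuad n g (maxExpG g p + 1) p []).2
      refine ⟨k + 1, ?_⟩
      rw [ev_eq_of_polyEq h.2 z, ev_mulN, hk, onePlusSq, ev_append, ev_powQN, ev_var]
      simp [ev, QMvPoly.toMv_const, toFun_apply]
      ring
    · exact ⟨0, by simp⟩
    · exact ⟨0, by simp⟩

/-- CONTENT REMOVAL with the pre-test: strip the power of `X_g`, then the powers of `1 + X_g²`. [folklore] -/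
def stripCI (n g : ℕ) (p : QMvPoly) : QMvPoly :=
  let q := stripG n g p
  stripQuadI n g (maxExpG g q + 1) q

/-- If `p(z) = 0` and `z_g ≠ 0` then `(stripCI p)(z) = 0`. [folklore] -/
theorem ev_stripCI_eq_zero (z : EuclideanSpace ℝ (Fin n)) (g : Fin n) (hg : z g ≠ 0) {p : QMvPoly} (hp : ev n p z = 0) :
    ev n (stripCI n g p) z = 0 := by
  have h1 := ev_stripG z g p
  rw [hp] at h1
  have h2 : ev n (stripG n g p) z = 0 := by
    rcases mul_eq_zero.1 h1 with h | h
    · exact absurd (pow_eq_zero_iff' |>.1 h).1 hg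
    · exact h
  obtain ⟨k, hk⟩ := ev_stripQuadI z g (maxExpG g (stripG n g p) + 1) (stripG n g p)
  rw [h2] at hk
  have hpos : (1 + z g ^ 2) ^ k ≠ 0 := pow_ne_zero _ (by positivity)
  rcases mul_eq_zero.1 hk.symm with h | h
  · exact absurd h hpos
  · simpa [stripCI] using h

/-- Substitute-and-strip for ONE law with the pre-test (untouched if `X_i` does not occur). [folklore] -/
def substStripI (n g i : ℕ) (num c : QMvPoly) (P : QMvPoly) : QMvPoly :=
  if degIn i P = 0 then P else stripCI n g (substLawN i num c P)

/-- Laws stay laws under `substStripI`. [folklore] -/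
theorem ev_substStripI_eq_zero (z : EuclideanSpace ℝ (Fin n)) (g i : Fin n) (num c : QMvPoly) (hg : z g ≠ 0)
    (hz : ev n c z * z i = ev n num z) {p : QMvPoly} (hp : ev n p z = 0) : ev n (substStripI n g i num c p) z = 0 := by
  unfold substStripI
  split_ifs with hd
  · exact hp
  · exact ev_stripCI_eq_zero z g hg (ev_substLawN_eq_zero z i num c hz hp)

/-- **THE TRANSCRIPT CHECK with content removal, pre-tested variant**: as `etreeCheckH` (only touched laws are stripped), with the divisibility pre-test. [folklore] -/
def etreeCheckI (n g : ℕ) : List QMvPoly → List QMvPoly → List ℕ → List QMvPoly → ETree → Bool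
  | hyps, pins, zs, nonneg, .leaf c => pointCheckP n hyps pins zs nonneg c
  | hyps, pins, zs, nonneg, .chunk comb T t =>
      polyEq T (idealComb hyps comb) && etreeCheckI n g (hyps ++ [T]) pins zs nonneg t
  | hyps, pins, zs, nonneg, .split π nz z => etreeCheckI n g hyps (pins ++ [π]) zs nonneg nz && etreeCheckI n g (hyps ++ [π]) pins zs nonneg z
  | hyps, pins, zs, nonneg, .elim k i κ pe t =>
      let L := hyps.getD k []
      let c := coeffIn i L
      let num := QMvPoly.smul (-1) (restIn i L)
      decide (i < n) && decide (g < n) && hasVarPin n g pins && decide (κ ≠ 0) && decide (degIn i L ≤ 1) &&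
        polyEq c (QMvPoly.smul κ (pinProductN pins pe)) &&
        etreeCheckI n g (hyps.map (substStripI n g i num c)) (pins.map (substLawN i num c)) zs (nonneg.map (substSignN i num c)) t
  | hyps, pins, zs, nonneg, .force k j κ pe e t =>
      decide (j < n) && decide (κ ≠ 0) && decide (1 ≤ e) &&
        polyEq (hyps.getD k []) (QMvPoly.smul κ (mulN (pinProductN pins pe) (powQN (QMvPoly.var n j) e))) &&
        etreeCheckI n g (hyps ++ [QMvPoly.var n j]) pins zs nonneg t

/-- **SOUNDNESS (pre-tested variant).** [folklore] -/
theorem not_pointDatum_of_etreeCheckI (g : ℕ) : ∀ (t : ETree) {hyps pins : List QMvPoly} {zs : List ℕ} {nonneg : List QMvPoly},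
    etreeCheckI n g hyps pins zs nonneg t = true → ¬ PointDatum n hyps pins zs nonneg := by
  intro t
  induction t with
  | leaf c => intro hyps pins zs nonneg h; exact not_pointDatum_of_pointCheckP h
  | chunk comb T t ih =>
    intro hyps pins zs nonneg h hd
    simp only [etreeCheckI, Bool.and_eq_true] at h
    obtain ⟨z, hh, hp, hz, hq⟩ := hd
    refine ih h.2 ⟨z, ?_, hp, hz, hq⟩
    intro L hL
    rcases List.mem_append.1 hL with hL' | hL'
    · exact hh L hL'
    · rw [List.mem_singleton.1 hL', ev_eq_of_polyEq h.1 z, ev_idealComb_eq_zero z hyps hh]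
  | split π nz zt ihnz ihz =>
    intro hyps pins zs nonneg h hd
    simp only [etreeCheckI, Bool.and_eq_true] at h
    obtain ⟨z, hh, hp, hz, hq⟩ := hd
    by_cases hπ : ev n π z = 0
    · refine ihz h.2 ⟨z, ?_, hp, hz, hq⟩
      intro L hL
      rcases List.mem_append.1 hL with hL' | hL'
      · exact hh L hL'
      · rw [List.mem_singleton.1 hL']; exact hπ
    · refine ihnz h.1 ⟨z, hh, ?_, hz, hq⟩
      intro π' hπ'
      rcases List.mem_append.1 hπ' with h' | h'
      · exact hp π' h'
      · rw [List.mem_singleton.1 h']; exact hπ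
  | elim k i κ pe t ih =>
    intro hyps pins zs nonneg h hd
    simp only [etreeCheckI, Bool.and_eq_true, decide_eq_true_eq] at h
    obtain ⟨⟨⟨⟨⟨⟨hi, hgn⟩, hvp⟩, hκ⟩, hdeg⟩, hc⟩, ht⟩ := h
    obtain ⟨z, hh, hp, hz, hq⟩ := hd
    set L := hyps.getD k [] with hL
    set c := coeffIn i L with hc_def
    set num := QMvPoly.smul (-1) (restIn i L) with hnum
    have hcz : ev n c z ≠ 0 := by
      rw [ev_eq_of_polyEq hc z, ev_smul, ev_pinProductN]
      exact mul_ne_zero (by exact_mod_cast hκ) (ev_pinProduct_ne_zero z pins pe hp)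
    have hLz : ev n L z = 0 := ev_getD_eq_zero hh k
    have hlin := ev_linear_split z ⟨i, hi⟩ L hdeg
    have hzi : ev n c z * z ⟨i, hi⟩ = ev n num z := by
      rw [hnum, ev_smul]; push_cast
      have : z ⟨i, hi⟩ * ev n c z + ev n (restIn i L) z = 0 := by rw [← hLz, hlin]
      linarith
    have hzg : z ⟨g, hgn⟩ ≠ 0 := zg_ne_zero_of_hasVarPin (g := ⟨g, hgn⟩) hvp hp
    refine ih ht ⟨z, ?_, ?_, hz, ?_⟩
    · intro L' hL'
      obtain ⟨P, hP, rfl⟩ := List.mem_map.1 hL'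
      exact ev_substStripI_eq_zero z ⟨g, hgn⟩ ⟨i, hi⟩ num c hzg hzi (hh P hP)
    · intro π' hπ'
      obtain ⟨P, hP, rfl⟩ := List.mem_map.1 hπ'
      exact ev_substLawN_ne_zero z ⟨i, hi⟩ num c hzi hcz (hp P hP)
    · intro q' hq'
      obtain ⟨P, hP, rfl⟩ := List.mem_map.1 hq'
      exact ev_substSignN_nonneg z ⟨i, hi⟩ num c hzi (hq P hP)
  | force k j κ pe e t ih =>
    intro hyps pins zs nonneg h hd
    simp only [etreeCheckI, Bool.and_eq_true, decide_eq_true_eq] at h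
    obtain ⟨⟨⟨⟨hj, hκ⟩, he⟩, hform⟩, ht⟩ := h
    obtain ⟨z, hh, hp, hz, hq⟩ := hd
    have hLz : ev n (hyps.getD k []) z = 0 := ev_getD_eq_zero hh k
    rw [ev_eq_of_polyEq hform z, ev_smul, ev_mulN, ev_pinProductN, ev_powQN, ev_var z ⟨j, hj⟩] at hLz
    have hzj : z ⟨j, hj⟩ = 0 := by
      have h1 : (κ : ℝ) ≠ 0 := by exact_mod_cast hκ
      have h2 := ev_pinProduct_ne_zero z pins pe hp
      have h3 : z ⟨j, hj⟩ ^ e = 0 := by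
        rcases mul_eq_zero.1 hLz with h | h
        · exact absurd h h1
        · rcases mul_eq_zero.1 h with h' | h'
          · exact absurd h' h2
          · exact h'
      exact pow_eq_zero_iff (by omega) |>.1 h3
    refine ih ht ⟨z, ?_, hp, hz, hq⟩
    intro L hL
    rcases List.mem_append.1 hL with hL' | hL'
    · exact hh L hL'
    · rw [List.mem_singleton.1 hL', ev_var z ⟨j, hj⟩]; exact hzj

/-- **THE KILL CHECK, pre-tested content removal** (`g` = the pinned tilt letter). [folklore] -/
def killCheckI (n g : ℕ) (hyps pins : List QMvPoly) (zs : List ℕ) (nonneg : List QMvPoly) (J : List ℕ) (t : ETree) : Bool :=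
  (J.all fun j => decide (j < n)) && etreeCheckI n g hyps (pins ++ [sumSq n J]) zs nonneg t

/-- **SOUNDNESS OF THE KILL CHECK (pre-tested variant).** [folklore] -/
theorem kills_of_killCheckI {g : ℕ} {hyps pins : List QMvPoly} {zs : List ℕ} {nonneg : List QMvPoly} {J : List ℕ} {t : ETree}
    (h : killCheckI n g hyps pins zs nonneg J t = true) : Kills n hyps pins zs nonneg J := by
  simp only [killCheckI, Bool.and_eq_true, List.all_eq_true, decide_eq_true_eq] at h
  obtain ⟨-, ht⟩ := h
  intro z hh hp hz hq j hjJ hj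
  by_contra hne
  refine not_pointDatum_of_etreeCheckI g t ht ⟨z, hh, ?_, hz, hq⟩
  intro π hπ
  rcases List.mem_append.1 hπ with h' | h'
  · exact hp π h'
  · rw [List.mem_singleton.1 h', ev_sumSq]
    have hnn : ∀ x ∈ J.map (fun j => ev n (QMvPoly.var n j) z * ev n (QMvPoly.var n j) z), (0 : ℝ) ≤ x := by
      intro x hx
      obtain ⟨j', -, rfl⟩ := List.mem_map.1 hx
      exact mul_self_nonneg _
    have hmem : ev n (QMvPoly.var n j) z * ev n (QMvPoly.var n j) z ∈
        J.map (fun j => ev n (QMvPoly.var n j) z * ev n (QMvPoly.var n j) z) := List.mem_map.2 ⟨j, hjJ, rfl⟩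
    have hle := List.single_le_sum hnn _ hmem
    have hpos : 0 < ev n (QMvPoly.var n j) z * ev n (QMvPoly.var n j) z := by
      rw [ev_var z ⟨j, hj⟩]; exact mul_self_pos.2 hne
    exact ne_of_gt (lt_of_lt_of_le hpos hle)

/-! ### Self-test (`decide +kernel`) -/

/-- The toy transcript of `…JetCertPsatzElimG` replays identically in the pre-tested variant. [folklore] -/
theorem example_killCheckI :
    killCheckI 3 0 [[([1, 1, 0], (1 : ℚ)), ([0, 0, 0], (-1 : ℚ)), ([2, 0, 0], (-1 : ℚ))], [([0, 1, 1], (1 : ℚ)), ([1, 0, 1], (-1 : ℚ))]]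
      [QMvPoly.var 3 0] [] [] [2]
      (.elim 0 1 1 [1] (.force 1 2 1 [] 1 (.elim 2 2 1 [] (.leaf { steps := [], comb := [], e := [0, 1], sos0 := [], sosG := [] })))) = true := by
  decide +kernel

/-- The pre-test itself: `(1+g²)·(s + g)` is divisible, `s + g²` is not (`decide +kernel`). [folklore] -/
theorem example_quadDivisible :
    quadDivisible 0 [([0, 1, 0], (1 : ℚ)), ([2, 1, 0], (1 : ℚ)), ([1, 0, 0], (1 : ℚ)), ([3, 0, 0], (1 : ℚ))] = true ∧
      quadDivisible 0 [([0, 1, 0], (1 : ℚ)), ([2, 0, 0], (1 : ℚ))] = false := by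
  decide +kernel

end Summit.NavierStokesRegularity.NavierStokesRegularity.Theorems.PoloidalWindowDoorLrcModEntireJetCertPsatzElimI

end
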